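import Mathlib.GroupTheory.PushoutI
import Mathlib.GroupTheory.ResiduallyFinite
import Literature.Topology.FourManifolds.SurfaceGroupAmalgam
import Literature.Topology.FourManifolds.SurfaceGroupGenusOne
import Mathlib.Data.ZMod.Basic
import Literature.GroupTheory.CombinatorialGroupTheory.FreeGroupAmalgamSeparation
import Literature.GroupTheory.CombinatorialGroupTheory.SurfaceRelatorPrimitive
import Literature.GroupTheory.CombinatorialGroupTheory.CyclicAmalgamResiduallyFinite
import HarnessLib

/-!
# Surface groups are residually finite

Topic `Literature/Topology/FourManifolds`; theorems only.  The orientable surface group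
`S_g = ⟨a₁, b₁, …, a_g, b_g ∣ ∏ [aᵢ, bᵢ]⟩` (`SurfaceGroup g` of `GroupTrisections.lean`) is
residually finite for every genus `g` (`surfaceGroup_residuallyFinite`; genus `0` and `1` — the
trivial group and `ℤ²` (`surfaceGroupOneEquiv`) — are the elementary cases, the content is
`g ≥ 2`: `surfaceGroup_residuallyFinite_of_two_le`).

Classically: Baumslag 1962 (surface groups are residually free), Hempel 1972 (a direct
topological proof), or linearity + Malcev.  OUR PROOF is algebraic: by Seifert–van Kampen along a
circle separating one handle from the others, `S_{1+h}` is the amalgamated free product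
`F⟨a₁,b₁⟩ *_ℤ F⟨a₂,…,b_{1+h}⟩` with `1 ↦ [a₁,b₁]` and `1 ↦ (∏_{i ≥ 2} [aᵢ,bᵢ])⁻¹` (tree:
`surfaceGroup_exists_mulEquiv_of_pushout_add`, instantiated on Mathlib's `Monoid.PushoutI`), both
maps injective since free groups are torsion-free and the relator words are nontrivial
(`surfaceRelator_ne_one`, `SurfaceRelatorPrimitive.lean`); and a free
product of free groups of finite rank with a cyclic amalgamation is residually finite — Baumslag's
theorem, `Literature.GroupTheory.CombinatorialGroupTheory.pushoutI_freeGroup_int_residuallyFinite`.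

## References

* G. Baumslag, *On generalised free products*, Math. Z. 78 (1962) 423–438; *On the residual
  finiteness of generalised free products of nilpotent groups*, Trans. AMS 106 (1963) 193–209.
  [Baumslag1963]
* J. Hempel, *Residual finiteness of surface groups*, Proc. AMS 32 (1972) 323.
* A. Hatcher, *Algebraic Topology* (2002), §1.2 (van Kampen for `Σ_g`). [HatcherAT2002]
-/

namespace Literature.Topology.FourManifolds

open Monoid Function

/-- Residual finiteness pulls back along injective homomorphisms. [folklore] -/
private theorem residuallyFinite_of_injective {G : Type*} [Group G] {K : Type*} [Group K]
    [Group.ResiduallyFinite K] (f : G →* K) (hf : Injective f) : Group.ResiduallyFinite G := by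
  refine Group.residuallyFinite_of_forall_exists_finite_monoidHom fun g hg => ?_
  obtain ⟨N, hN⟩ := Group.exists_finiteIndexNormalSubgroup_notMem (f g)
    (fun h => hg (hf (by rw [h, map_one])))
  haveI := N.toSubgroup.finite_quotient_of_finiteIndex
  refine ⟨K ⧸ N.toSubgroup, inferInstance, inferInstance, (QuotientGroup.mk' N.toSubgroup).comp f, ?_⟩
  rw [MonoidHom.comp_apply, QuotientGroup.mk'_apply, ne_eq, QuotientGroup.eq_one_iff]
  exact hN

/-- `ℤ × ℤ` (written multiplicatively) is residually finite: `(m, n) ≠ 0` survives modulo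
`N = |m| + |n| + 1`. [folklore] -/
private theorem residuallyFinite_multiplicative_int_prod :
    Group.ResiduallyFinite (Multiplicative (ℤ × ℤ)) := by
  refine Group.residuallyFinite_of_forall_exists_finite_monoidHom fun x hx => ?_
  let m : ℤ := (Multiplicative.toAdd x).1
  let n : ℤ := (Multiplicative.toAdd x).2
  let N : ℕ := m.natAbs + n.natAbs + 1
  haveI : NeZero N := ⟨Nat.succ_ne_zero _⟩
  let q : ℤ × ℤ →+ ZMod N × ZMod N :=
    (Int.castAddHom (ZMod N)).prodMap (Int.castAddHom (ZMod N))
  refine ⟨Multiplicative (ZMod N × ZMod N), inferInstance, inferInstance,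
    AddMonoidHom.toMultiplicative q, fun h => hx ?_⟩
  have h1 : q (Multiplicative.toAdd x) = 0 := congrArg Multiplicative.toAdd h
  have hm : ((m : ℤ) : ZMod N) = 0 := congrArg Prod.fst h1
  have hn : ((n : ℤ) : ZMod N) = 0 := congrArg Prod.snd h1
  rw [ZMod.intCast_zmod_eq_zero_iff_dvd] at hm hn
  have hm0 : m = 0 := by
    by_contra h0
    have := Nat.le_of_dvd (Int.natAbs_pos.mpr h0) (Int.natCast_dvd.mp hm)
    omega
  have hn0 : n = 0 := by
    by_contra h0
    have := Nat.le_of_dvd (Int.natAbs_pos.mpr h0) (Int.natCast_dvd.mp hn)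
    omega
  have : Multiplicative.toAdd x = 0 := Prod.ext hm0 hn0
  exact Multiplicative.toAdd.injective this

/-- **Surface groups of genus `g ≥ 2` are residually finite** — the substantial case, via the
cyclic amalgam `S_{1+h} = F₂ *_ℤ F_{2h}` and Baumslag's theorem. [cite: Baumslag1963, Theorem 1] -/
theorem surfaceGroup_residuallyFinite_of_two_le (g : ℕ) (hg : 2 ≤ g) :
    Group.ResiduallyFinite (SurfaceGroup g) := by
  classical
  obtain ⟨h, rfl⟩ : ∃ h, g = 1 + h := ⟨g - 1, by omega⟩
  have hh : 1 ≤ h := by omega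
  -- the two free factors and the amalgamated `ℤ`
  let α : Bool → Type := fun b => surfaceGen (Bool.rec (motive := fun _ => ℕ) 1 h b)
  let c : ∀ b : Bool, FreeGroup (α b) := fun b =>
    Bool.rec (motive := fun b => FreeGroup (α b)) (surfaceRelator 1) (surfaceRelator h)⁻¹ b
  have hc : ∀ b, c b ≠ 1 := by
    intro b
    cases b
    · exact Literature.GroupTheory.CombinatorialGroupTheory.surfaceRelator_ne_one le_rfl
    · exact inv_ne_one.mpr (Literature.GroupTheory.CombinatorialGroupTheory.surfaceRelator_ne_one hh)
  let φ : ∀ b : Bool, Multiplicative ℤ →* FreeGroup (α b) := fun b => zpowersHom (FreeGroup (α b)) (c b)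
  have hφ : ∀ b, Injective (φ b) := fun b =>
    Literature.GroupTheory.CombinatorialGroupTheory.zpowersHom_injective (hc b)
  haveI : ∀ b, Finite (α b) := fun b => by dsimp only [α]; infer_instance
  haveI hRF : Group.ResiduallyFinite (PushoutI φ) :=
    Literature.GroupTheory.CombinatorialGroupTheory.pushoutI_freeGroup_int_residuallyFinite φ hφ
  -- the van Kampen maps `u`, `v`
  let u : FreeGroup (surfaceGen 1) →* PushoutI φ := PushoutI.of (φ := φ) false
  let v : FreeGroup (surfaceGen h) →* PushoutI φ := PushoutI.of (φ := φ) true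
  have e3 : ∀ b, φ b (Multiplicative.ofAdd 1) = c b := fun b => by simp [φ]
  have hoc : ∀ b, PushoutI.of (φ := φ) b (c b) = PushoutI.base φ (Multiplicative.ofAdd 1) := by
    intro b
    rw [← e3]
    exact PushoutI.of_apply_eq_base φ b _
  have hcf : c false = surfaceRelator 1 := rfl
  have hct : c true = (surfaceRelator h)⁻¹ := rfl
  have hu1 : u (surfaceRelator 1) = PushoutI.base φ (Multiplicative.ofAdd 1) := by
    rw [← hoc false, hcf]
  have hv1 : v (surfaceRelator h) = (PushoutI.base φ (Multiplicative.ofAdd 1))⁻¹ := by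
    rw [← hoc true, hct, map_inv, inv_inv]
  have huv : u (surfaceRelator 1) * v (surfaceRelator h) = 1 := by
    rw [hu1, hv1, mul_inv_cancel]
  -- existence: a homomorphism `PushoutI φ → S_{1+h}` restricting to the two inclusions
  let S := SurfaceGroup (1 + h)
  let ι₁ : FreeGroup (surfaceGen 1) →* S := (PresentedGroup.mk _).comp (genInclAdd 1 h)
  let ι₂ : FreeGroup (surfaceGen h) →* S := (PresentedGroup.mk _).comp (genShiftAdd 1 h)
  have hrel : ι₁ (surfaceRelator 1) * ι₂ (surfaceRelator h) = 1 := by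
    change PresentedGroup.mk _ (genInclAdd 1 h (surfaceRelator 1)) *
      PresentedGroup.mk _ (genShiftAdd 1 h (surfaceRelator h)) = 1
    rw [← map_mul, ← surfaceRelator_add]
    exact (QuotientGroup.eq_one_iff _).mpr (Subgroup.subset_normalClosure (Set.mem_singleton _))
  let f : ∀ b : Bool, FreeGroup (α b) →* S := fun b =>
    Bool.rec (motive := fun b => FreeGroup (α b) →* S) ι₁ ι₂ b
  let k : Multiplicative ℤ →* S := zpowersHom S (ι₁ (surfaceRelator 1))
  have hfk : ∀ b, (f b).comp (φ b) = k := by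
    intro b
    refine MonoidHom.ext_mint ?_
    have e4 : k (Multiplicative.ofAdd 1) = ι₁ (surfaceRelator 1) := by simp [k]
    rw [MonoidHom.comp_apply, e3, e4]
    cases b
    · rfl
    · change ι₂ ((surfaceRelator h)⁻¹) = ι₁ (surfaceRelator 1)
      rw [map_inv]
      exact inv_eq_of_mul_eq_one_left hrel
  have hexists : ∃ F : PushoutI φ →* S, F.comp u = ι₁ ∧ F.comp v = ι₂ :=
    ⟨PushoutI.lift f k hfk,
      MonoidHom.ext fun x => PushoutI.lift_of (φ := φ) f k hfk (i := false) x,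
      MonoidHom.ext fun x => PushoutI.lift_of (φ := φ) f k hfk (i := true) x⟩
  have hunique : ∀ F F' : PushoutI φ →* PushoutI φ,
      F.comp u = F'.comp u → F.comp v = F'.comp v → F = F' := by
    intro F F' h₁ h₂
    refine PushoutI.hom_ext_nonempty fun b => ?_
    cases b
    · exact h₁
    · exact h₂
  obtain ⟨e, -, -⟩ := surfaceGroup_exists_mulEquiv_of_pushout_add u v huv hexists hunique
  exact residuallyFinite_of_injective e.toMonoidHom e.injective

/-- **Surface groups are residually finite** (every genus; `S_0 = 1`, `S_1 ≅ ℤ²`, and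
`surfaceGroup_residuallyFinite_of_two_le`). [cite: Baumslag1963, Theorem 1] -/
theorem surfaceGroup_residuallyFinite (g : ℕ) : Group.ResiduallyFinite (SurfaceGroup g) := by
  rcases Nat.lt_or_ge g 2 with hg | hg
  · interval_cases g
    · -- genus 0: the trivial group
      haveI : Subsingleton (SurfaceGroup 0) := by
        refine ⟨fun x y => ?_⟩
        obtain ⟨x, rfl⟩ := PresentedGroup.mk_surjective _ x
        obtain ⟨y, rfl⟩ := PresentedGroup.mk_surjective _ y
        rw [Subsingleton.elim x y]
      haveI : Finite (SurfaceGroup 0) := Finite.of_subsingleton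
      infer_instance
    · -- genus 1: `ℤ × ℤ`
      haveI := residuallyFinite_multiplicative_int_prod
      exact residuallyFinite_of_injective surfaceGroupOneEquiv.toMonoidHom
        surfaceGroupOneEquiv.injective
  · exact surfaceGroup_residuallyFinite_of_two_le g hg

end Literature.Topology.FourManifolds
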